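import Literature.Analysis.FluidPDE.AlbrittonKatoClassIntegralForm
import Literature.Analysis.FluidPDE.KNSSSmoothingHolds
import HarnessLib

/-!
# The long-lived factor of the Calderón splitting: a classical mild solution from small bounded `L^p` data

Analysis/FluidPDE proofs file (theorems only) on the discharge path of the corrected form of
`Literature.Analysis.FluidPDE.albritton_singular_point_of_blowup` (Albritton 2018, proof of
Prop. 4.5: "let `V` denote the mild solution of the Navier–Stokes equations … with initial data
`V₀`, such that `T*(V₀) ≥ 2T*(u₀)` … in addition, the mild solution `V` obeys
`sup_{t ∈ (0, 2T*)} t^{|α|/2} ‖∂^αV(·,t)‖_{L^∞} ≤ C(α, U₀, V₀)`"). In the tree's vocabulary: for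
`3 < p < ∞` there is `c > 0` such that every smooth divergence-free `V₀` with `|V₀| ≤ A` and
`V₀ ∈ L^p` generates, on `(0, c/A²)`, a field `V` with

* `(V, π_V)` a classical solution of the unforced unit-viscosity system (KNSS 2009, Prop. 4.1 and
  the classical upgrade `classical_of_smooth_isMildNSSolutionOn_holds` of the duality-form mild
  solution `isMildNSSolutionOn_of_integralForm`);
* `|V| ≤ 2A`, `‖V(t)‖_{L^p} ≤ 2‖V₀‖_{L^p}` (the bounded Oseen scheme `exists_local_oseen_solution`);
* the Oseen integral identities from time `0` (pointwise) and from every `s > 0` (a.e.,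
  `oseenMild_restart_holds`);
* `t^{1/2} ‖∇V(t)‖_∞ ≤ C` (KNSS 2009, Prop. 4.1, `k = 1`).

The lifespan `c/A²` is made as long as needed by taking `‖V₀‖_∞ = A` small
(`CalderonSplittingLp.exists_calderon_splitting_sup`) — the rôle of "`T*(V₀) ≥ 2T*(u₀)`".

## References

* D. Albritton, Anal. PDE 11 (2018) = arXiv:1612.04439, proof of Prop. 4.5. [Albritton2018]
* G. Koch, N. Nadirashvili, G. Seregin, V. Šverák, Acta Math. 203 (2009), Prop. 4.1, §4.
  [KochNadirashviliSereginSverak2009]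
* P. G. Lemarié-Rieusset, *The Navier–Stokes Problem in the 21st Century* (2016), Thm. 5.1,
  Thm. 9.12. [LemarieRieusset2016]
-/

noncomputable section

open MeasureTheory TopologicalSpace Set Function Filter Topology Metric
open scoped ENNReal NNReal Topology ContDiff

namespace Literature.Analysis.FluidPDE

namespace LongLivedOseenSolution

/-- The Oseen–Duhamel term only sees the fields at times in `(s, t)`. [folklore] -/
theorem oseenDuhamel_congr {E : Type*} [NormedAddCommGroup E] [InnerProductSpace ℝ E]
    [FiniteDimensional ℝ E] [MeasurableSpace E] [BorelSpace E] {ν s : ℝ} {u u' v v' : ℝ → E → E}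
    {t : ℝ} (hu : ∀ τ ∈ Ioo s t, u τ = u' τ) (hv : ∀ τ ∈ Ioo s t, v τ = v' τ) (x : E) :
    oseenDuhamel ν s u v t x = oseenDuhamel ν s u' v' t x := by
  rw [oseenDuhamel_apply, oseenDuhamel_apply]
  refine setIntegral_congr_fun measurableSet_Ioo fun τ hτ => ?_
  simp only [hu τ hτ, hv τ hτ]

/-- **The long-lived classical mild solution from small bounded `L^p` data** (Albritton 2018,
proof of Prop. 4.5, the solution `V`; Lemarié-Rieusset 2016, Thm. 5.1 for the bounded scheme,
KNSS 2009, Prop. 4.1 for smoothness and the gradient bound, Fabes–Jones–Rivière for the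
classical upgrade). For `3 < p < ∞` there is `c > 0` with: for every `A > 0` and every smooth
divergence-free `V₀` with `|V₀| ≤ A`, `V₀ ∈ L^p`, there are `V`, `π_V` on `(0, c/A²)` with the
properties listed in the module docstring. [cite: Albritton2018, Prop. 4.5 proof; KochNadirashviliSereginSverak2009, Prop. 4.1; LemarieRieusset2016, Thm. 5.1] -/
theorem exists_longLived_classical {p : ℝ≥0∞} [hp1 : Fact (1 ≤ p)] (hp₃ : 3 < p) (hp : p < ⊤) :
    ∃ c : ℝ, 0 < c ∧ ∀ ⦃A : ℝ⦄, 0 < A →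
      ∀ ⦃V₀ : EuclideanSpace ℝ (Fin 3) → EuclideanSpace ℝ (Fin 3)⦄, ContDiff ℝ (⊤ : ℕ∞) V₀ →
      VectorCalculus.IsDivFree V₀ → (∀ x, ‖V₀ x‖ ≤ A) → MemLp V₀ p volume →
      ∃ (V : ℝ → EuclideanSpace ℝ (Fin 3) → EuclideanSpace ℝ (Fin 3))
        (πV : ℝ → EuclideanSpace ℝ (Fin 3) → ℝ),
        IsClassicalNSSolutionOn (Ioo 0 (c / A ^ 2)) 1 0 V πV ∧
        (∀ t ∈ Ioo 0 (c / A ^ 2), ∀ x, ‖V t x‖ ≤ 2 * A) ∧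
        (∀ t ∈ Ioo 0 (c / A ^ 2), MemLp (V t) p volume ∧
          eLpNorm (V t) p volume ≤ 2 * eLpNorm V₀ p volume) ∧
        AEStronglyMeasurable (uncurry V)
          ((volume : Measure (ℝ × EuclideanSpace ℝ (Fin 3))).restrict (Ioo 0 (c / A ^ 2) ×ˢ univ)) ∧
        (∀ t ∈ Ioo 0 (c / A ^ 2), ∀ x,
          V t x = UnboundedOperators.heatExtension V₀ t x - oseenDuhamel 1 0 V V t x) ∧
        (∀ s t : ℝ, 0 < s → s < t → t < c / A ^ 2 → V t =ᵐ[volume] fun x =>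
          UnboundedOperators.heatExtension (V s) (t - s) x - oseenDuhamel 1 s V V t x) ∧
        ∃ C : ℝ, ∀ t ∈ Ioo 0 (c / A ^ 2), ∀ x, t ^ (1 / 2 : ℝ) * ‖fderiv ℝ (V t) x‖ ≤ C := by
  haveI : CompleteSpace (EuclideanSpace ℝ (Fin 3)) := FiniteDimensional.complete ℝ _
  obtain ⟨c, hc, hsol⟩ := exists_local_oseen_solution (p := p) hp1.out hp
  refine ⟨c, hc, fun A hA V₀ hV₀s hV₀div hV₀A hV₀p => ?_⟩
  set S : ℝ := c / A ^ 2 with hSdef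
  have hS : 0 < S := by positivity
  obtain ⟨V, hVm, hVbd, hVp, hVsl, hVeq, -, -⟩ :=
    hsol hA hV₀s.continuous.stronglyMeasurable hV₀A hV₀p 0
  simp only [zero_add, sub_zero] at hVm hVbd hVp hVsl hVeq
  -- ### the data
  have hV₀m : AEStronglyMeasurable V₀ volume := hV₀s.continuous.aestronglyMeasurable
  have hV₀bd : eLpNorm V₀ ∞ volume ≤ ENNReal.ofReal (2 * A) := by
    rw [eLpNorm_exponent_top]
    exact eLpNormEssSup_le_of_ae_bound (Eventually.of_forall fun x => (hV₀A x).trans (by linarith))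
  have hVbd' : ∀ t ∈ Ioo 0 S, eLpNorm (V t) ∞ volume ≤ ENNReal.ofReal (2 * A) := fun t ht => by
    rw [eLpNorm_exponent_top]
    exact eLpNormEssSup_le_of_ae_bound (Eventually.of_forall fun x => hVbd t ht x)
  have hVeq' : ∀ t ∈ Ioo 0 S, V t =ᵐ[volume] fun x =>
      UnboundedOperators.heatExtension V₀ (1 * (t - 0)) x - oseenDuhamel 1 0 V V t x := by
    intro t ht
    refine Eventually.of_forall fun x => ?_
    rw [one_mul, sub_zero]
    exact hVeq t ht x
  -- ### KNSS: smoothness and the gradient bound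
  obtain ⟨hsm, -, hder⟩ := knss2009_smoothing_holds (EuclideanSpace ℝ (Fin 3)) one_pos hS
    (by positivity : (0 : ℝ) ≤ 2 * A) hV₀m hV₀bd hVm hVbd' hVeq'
  have hident : ∀ z ∈ Ioo 0 S ×ˢ (univ : Set (EuclideanSpace ℝ (Fin 3))),
      uncurry V z = uncurry (fun t x =>
        UnboundedOperators.heatExtension V₀ (1 * (t - 0)) x - oseenDuhamel 1 0 V V t x) z := by
    rintro ⟨t, x⟩ ⟨ht, -⟩
    simp only [uncurry_apply_pair, one_mul, sub_zero]
    exact hVeq t ht x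
  have hVsm : IsSmoothSpaceTimeOn (Ioo 0 S) V := hsm.congr hident
  have hgrad : ∃ C : ℝ, ∀ t ∈ Ioo 0 S, ∀ x, t ^ (1 / 2 : ℝ) * ‖fderiv ℝ (V t) x‖ ≤ C := by
    obtain ⟨C₁, hC₁⟩ := hder 1 0
    refine ⟨C₁, fun t ht x => ?_⟩
    have hb := hC₁ t ht x
    have hfun : (fun y => iteratedDeriv 0 (fun τ =>
        UnboundedOperators.heatExtension V₀ (1 * (τ - 0)) y - oseenDuhamel 1 0 V V τ y) t) = V t := by
      funext y
      rw [iteratedDeriv_zero, one_mul, sub_zero]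
      exact (hVeq t ht y).symm
    rw [hfun] at hb
    have h1 := norm_iteratedFDeriv_fderiv (𝕜 := ℝ) (f := V t) (x := x) (n := 0)
    rw [norm_iteratedFDeriv_zero] at h1
    have hexp : ((1 : ℕ) : ℝ) / 2 + ((0 : ℕ) : ℝ) = (1 : ℝ) / 2 := by norm_num
    rw [hexp, ← h1, sub_zero] at hb
    exact hb
  -- ### the restart identities (semigroup property of the Oseen formulation)
  set z : ℝ → EuclideanSpace ℝ (Fin 3) → EuclideanSpace ℝ (Fin 3) := Function.update V 0 V₀ with hzdef
  have hz0 : z 0 = V₀ := by simp [hzdef]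
  have hzt : ∀ t, t ≠ 0 → z t = V t := fun t ht => by simp [hzdef, ht]
  have hzpos : ∀ t, 0 < t → z t = V t := fun t ht => hzt t ht.ne'
  have hzm : AEStronglyMeasurable (uncurry z)
      ((volume : Measure (ℝ × EuclideanSpace ℝ (Fin 3))).restrict (Ioo 0 S ×ˢ univ)) := by
    refine hVm.congr ?_
    filter_upwards [ae_restrict_mem (measurableSet_Ioo.prod MeasurableSet.univ)] with ⟨t, x⟩ ht
    simp only [uncurry_apply_pair]
    rw [hzpos t ht.1.1]
  have hzbd : ∀ T₁ ∈ Ioo 0 S, ∃ C : ℝ≥0∞, C < ⊤ ∧ ∀ t ∈ Ico 0 T₁, eLpNorm (z t) ∞ volume ≤ C := by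
    intro T₁ hT₁
    refine ⟨ENNReal.ofReal (2 * A), ENNReal.ofReal_lt_top, fun t ht => ?_⟩
    rcases eq_or_lt_of_le ht.1 with h0 | hpos
    · rw [← h0, hz0]; exact hV₀bd
    · rw [hzpos t hpos]; exact hVbd' t ⟨hpos, ht.2.trans hT₁.2⟩
  have hzeq : ∀ t ∈ Ioo 0 S, z t =ᵐ[volume] fun x =>
      UnboundedOperators.heatExtension (z 0) (1 * t) x - oseenDuhamel 1 0 z z t x := by
    intro t ht
    refine Eventually.of_forall fun x => ?_
    rw [hzpos t ht.1, hz0, one_mul, hVeq t ht x]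
    congr 1
    exact oseenDuhamel_congr (fun τ hτ => (hzpos τ hτ.1).symm) (fun τ hτ => (hzpos τ hτ.1).symm) x
  have hrestart : ∀ s t : ℝ, 0 < s → s < t → t < S → V t =ᵐ[volume] fun x =>
      UnboundedOperators.heatExtension (V s) (t - s) x - oseenDuhamel 1 s V V t x := by
    intro s t hs hst htS
    have h := oseenMild_restart_holds (EuclideanSpace ℝ (Fin 3)) one_pos hS hzm
      (by rw [hz0]; exact hV₀m) hzbd hzeq hs hst htS
    rw [hzpos t (hs.trans hst), hzpos s hs] at h
    filter_upwards [h] with x hx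
    rw [hx, one_mul]
    congr 1
    exact oseenDuhamel_congr (fun τ hτ => hzpos τ (hs.trans hτ.1)) (fun τ hτ => hzpos τ (hs.trans hτ.1)) x
  -- ### the duality-form mild solution from `V₀` and the classical upgrade
  obtain ⟨U₀, hU₀⟩ := exists_isDistributionOf_of_memLp (p := p) hV₀p
  have hdivw : IsWeaklyDivFree V₀ :=
    VectorCalculus.IsDivFree.isWeaklyDivFree_holds hV₀div (hV₀s.of_le (by norm_cast))
  have hp3r : (3 : ℝ) < p.toReal := by
    have h' := ENNReal.toReal_strict_mono hp.ne hp₃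
    simpa using h'
  set α : ℝ := (1 - 3 / p.toReal) / 2 with hαdef
  have hα0 : 0 ≤ α := by
    have : 3 / p.toReal < 1 := (div_lt_one (by linarith)).2 hp3r
    rw [hαdef]; linarith
  have hNp : eLpNorm V₀ p volume < ⊤ := hV₀p.eLpNorm_lt_top
  have hzmemp : ∀ t ∈ Ioo 0 S, MemLp (z t) p volume := fun t ht => by
    rw [hzpos t ht.1]
    exact ⟨hVsl t ht, (hVp t ht).trans_lt (ENNReal.mul_lt_top (by norm_num) hNp)⟩
  have hfixz : ∀ t ∈ Ioo 0 S, z t =ᵐ[volume] fun x =>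
      UnboundedOperators.heatExtension V₀ t x - kochTataruBilinear z z t x := by
    intro t ht
    filter_upwards [hzeq t ht] with x hx
    rw [hx, hz0, one_mul, kochTataruBilinear_eq_oseenDuhamel]
  have hmild : IsMildNSSolutionOn (Ico 0 S) 1 0 V₀ z := by
    have hloc : ∀ {T₁ : ℝ}, 0 < T₁ → T₁ < S → IsMildNSSolutionOn (Ico 0 T₁) 1 0 V₀ z := by
      intro T₁ hT₁ hT₁S
      set T₂ : ℝ := (T₁ + S) / 2 with hT₂def
      have hT₁₂ : T₁ < T₂ := by rw [hT₂def]; linarith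
      have hT₂S : T₂ < S := by rw [hT₂def]; linarith
      have hT₂ : 0 < T₂ := hT₁.trans hT₁₂
      have hzm₂ : AEStronglyMeasurable (uncurry z)
          ((volume : Measure (ℝ × EuclideanSpace ℝ (Fin 3))).restrict (Ioo 0 T₂ ×ˢ univ)) :=
        hzm.mono_measure (Measure.restrict_mono (prod_mono (Ioo_subset_Ioo_right hT₂S.le) Subset.rfl) le_rfl)
      set Np : ℝ := (2 * eLpNorm V₀ p volume).toReal with hNpdef
      have hNp0 : 0 ≤ Np := ENNReal.toReal_nonneg
      have hLp : ∀ τ ∈ Ioo 0 T₂, eLpNorm (z τ) p volume ≤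
          ENNReal.ofReal ((Np * T₂ ^ α) * τ ^ (-α)) := by
        intro τ hτ
        rw [hzpos τ hτ.1]
        refine (hVp τ ⟨hτ.1, hτ.2.trans hT₂S⟩).trans ?_
        have e : 2 * eLpNorm V₀ p volume = ENNReal.ofReal Np := by
          rw [hNpdef, ENNReal.ofReal_toReal (ENNReal.mul_ne_top (by norm_num) hNp.ne)]
        rw [e]
        exact ENNReal.ofReal_le_ofReal (le_mul_rpow_mul_rpow_neg hNp0 hα0 hτ.1 hτ.2.le)
      have hinf : ∀ τ ∈ Ioo 0 T₂, eLpNorm (z τ) ∞ volume ≤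
          ENNReal.ofReal (((2 * A + 1) * T₂ ^ (1 / 2 : ℝ)) * τ ^ (-(1 / 2 : ℝ))) := by
        intro τ hτ
        rw [hzpos τ hτ.1]
        calc eLpNorm (V τ) ∞ volume ≤ ENNReal.ofReal (2 * A) := hVbd' τ ⟨hτ.1, hτ.2.trans hT₂S⟩
          _ ≤ ENNReal.ofReal (2 * A + 1) := ENNReal.ofReal_le_ofReal (by linarith)
          _ ≤ _ := ENNReal.ofReal_le_ofReal
              (le_mul_rpow_mul_rpow_neg (by positivity) (by norm_num) hτ.1 hτ.2.le)
      have hb : 0 < (2 * A + 1) * T₂ ^ (1 / 2 : ℝ) := by positivity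
      obtain ⟨hwm, -, -, -, hX⟩ := kato_cutoff_bounds hzm₂
        (fun τ hτ => (hzmemp τ ⟨hτ.1, hτ.2.trans hT₂S⟩).1) hp₃ hp hb
        (by simpa only [hαdef] using hLp) hinf hT₁₂.le
      exact isMildNSSolutionOn_of_integralForm hU₀ hdivw (p := p) hz0 hwm hX
        (fun s hs => by rw [indicator_of_mem (mem_Iio.2 hs)])
        (fun t ht => hzmemp t ⟨ht.1, ht.2.trans hT₁S⟩)
        (fun t ht => UnboundedOperators.memLp_heatExtension_holds hV₀p hp1.out ht.1)
        fun t ht => hfixz t ⟨ht.1, ht.2.trans hT₁S⟩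
    refine ⟨fun t ht => ?_, fun t ht => ?_⟩
    · exact (hloc (by linarith [ht.1, hS] : 0 < (t + S) / 2) (by linarith [ht.2])).1 t
        ⟨ht.1, by linarith [ht.2]⟩
    · exact (hloc (by linarith [ht.1, hS] : 0 < (t + S) / 2) (by linarith [ht.2])).2 t
        ⟨ht.1, by linarith [ht.2]⟩
  have hmildV : IsMildNSSolutionOn (Ioo 0 S) 1 0 V₀ V :=
    (hmild.mono Ioo_subset_Ico_self).congr_ae_Ioo fun t ht =>
      Eventually.of_forall fun x => by rw [hzpos t ht.1]
  have hbdd : ∀ T₁ ∈ Ioo 0 S, ∃ C : ℝ≥0∞, C < ⊤ ∧ ∀ t ∈ Ioo 0 T₁, eLpNorm (V t) ∞ volume ≤ C :=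
    fun T₁ hT₁ => ⟨ENNReal.ofReal (2 * A), ENNReal.ofReal_lt_top,
      fun t ht => hVbd' t ⟨ht.1, ht.2.trans hT₁.2⟩⟩
  obtain ⟨πV, hcl⟩ := classical_of_smooth_isMildNSSolutionOn_holds (EuclideanSpace ℝ (Fin 3))
    one_pos hS hV₀m (fun a ha => hU₀.integrable_heatKernel_mul_norm ha) hVsm hbdd hmildV
  -- ### assembly
  refine ⟨V, πV, hcl, hVbd, fun t ht => ⟨(hzpos t ht.1) ▸ hzmemp t ht, hVp t ht⟩, hVm, hVeq,
    hrestart, hgrad⟩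

end LongLivedOseenSolution

end Literature.Analysis.FluidPDE

end
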